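import Literature.Algebra.Lie.LefschetzTriple
import Literature.Geometry.Kaehler.ComplexTorusTotalLieAlgebraRatLefschetzTriple
import Literature.Geometry.Kaehler.ComplexTorusNeronSeveriLieAlgebraRatPicardOne
import Literature.Algebra.Lie.LefschetzTripleTransport
import Literature.Algebra.Lie.SpecialLinearSimple
import HarnessLib

/-!
# `(𝔤_tot(X; ℚ), h)` and `(𝔤_NS(X; ℚ), h)` ARE Jordan–Lefschetz pairs: the complex torus and the abelian variety as
# instances of Looijenga–Lunts' abstract notion (§1 p. 7, §2 (2.1)–(2.2), §3 (3.3), (3.6))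

Layer `Literature/Geometry/Kaehler`, namespace `Literature.Geometry.Kaehler.ComplexTorus`; lane `lit-hodgefound` (Track 2
foundations library, Layer A), skeleton seat `lit-hodgefound-skel-1` (generation 38), row **A1-85** of
`run/shared/lean/pub/lit-hodgefound/SKELETON.md`.  The JUNCTION of row A1-84 (`Literature/Algebra/Lie/LefschetzTriple`:
the abstract `IsLefschetzTriple K h 𝔞`, `IsJordanLefschetzPair K h`, and (2.2) `𝔤 = 𝔤₋₂ ⊕ 𝔤₀ ⊕ 𝔤₂` proved for every
Jordan–Lefschetz pair) with the lane's concrete records, BY NAME: A1-71/A1-75/A1-79/A1-80/A1-81/A1-82/A1-83 (the total Lie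
algebra over `ℚ`, `totalLieAlgebraRat Φ`, its `ad h`-grading `totalLieAlgebraRatDeg Φ c`, generation by `𝔤_{±2}(ℚ)`, the
`𝔰𝔩₂`-triples `(e_η, h, f_η)` on the rational non-degenerate classes, semisimplicity `isSemisimple_totalLieAlgebraRat`) and
A1-60/A1-69/A1-78 (the Néron–Severi Lie algebra over `ℚ` of an abelian variety, `neronSeveriLieAlgebraRat Φ`, its grading,
its rational generators `neronSeveriRatGens`, `h ∈ 𝔤_NS(X; ℚ)`, semisimplicity `IsRiemannForm.isSemisimple_neronSeveriLieAlgebraRat`).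
THEOREMS ONLY, stated INSIDE the `ℚ`-Lie algebras `↥(totalLieAlgebraRat Φ)` and `↥(neronSeveriLieAlgebraRat Φ)` (whose Lie
structures are global instances): no definition, no instance, no local instance attribute, no named fact, no `sorry`
(D-0026 net debt `0`).

## Source, VERBATIM

E. Looijenga, V. A. Lunts, *A Lie algebra attached to a projective variety*, Invent. Math. **129** (1997) 361–412 (held
text `paper:arxiv-alg-geom_9604014`):

> (§1, p0007 L54–L78) "suppose that conversely, we are given a semisimple Lie algebra `𝔤`, a simple element `h ∈ 𝔤` […]
> and an abelian subalgebra `𝔞` of `𝔤` such that (i) […] for `e` in the domain of `f`, we have an `𝔰𝔩(2)`-triple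
> `(e, h, f_e)` and (ii) `𝔤` is as a Lie algebra generated by `𝔞` and the image of `f`. […] a Lefschetz triple and its
> first two items, `(𝔤, h)`, a Lefschetz pair."
> (§2, p0009 L109–L115) "Say that a Lefschetz pair `(𝔤, h)` is a Jordan–Lefschetz pair if `(𝔤, h, 𝔤₂)` is a Lefschetz
> triple. […] (2.2) Proposition. If `(𝔤, h)` is a Jordan–Lefschetz pair, then `𝔤 = 𝔤₋₂ ⊕ 𝔤₀ ⊕ 𝔤₂`".
> (§3 (3.3), p0013 L110–L115) "There is a natural identification `(𝔤_tot(X; ℝ), h) ≅ (𝔰𝔬(V^* ⊕ V), u)` […] `H^ev(X)[n]` is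
> […] a fundamental Jordan–Lefschetz module of `H²(X, ℝ)`."
> (Introduction, p0002 L46–L47) "The elements `e_κ, h, f_κ` make up a Lie subalgebra `𝔤_κ` of `𝔤𝔩(H(X))`
> isomorphic to `𝔰𝔩(2)`"; (§2 (2.6), p0010 L19) the type "`(A_{2m-1}, A_{m-1} + A_{m-1})` (`m ≥ 1`)" — for the
> elliptic curve `𝔤_tot(X) = 𝔤_κ ≅ 𝔰𝔩(2)` is the case `m = 1` (the identification (3.3) with `𝔰𝔬(V ⊕ V^*)` needs
> `g ≥ 2`: row A1-71's `finrank_totalLieAlgebraRat_of_finrank_eq_one`, `dim = 3 ≠ 6`).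
> (§3 (3.6), p0014 L71) "The Néron–Severi Lie algebra of the abelian variety `X` is of Jordan type."
> (§1 (1.9), p0006 L119–L122) "we often write `𝔤_*(X; K)` for the corresponding Lie algebra of `K`-points."

## What is formalised (all `theorem`s, proved)

With `h` the counting operator `countingG E` regarded as an element of the `ℚ`-Lie algebra `𝔤_tot(X; ℚ) = totalLieAlgebraRat Φ`
(resp. `𝔤_NS(X; ℚ) = neronSeveriLieAlgebraRat Φ`), `X = E/Φ(ℤ^ι)` a complex torus of dimension `g`:

* dictionary: `coe_lie_totalLieAlgebraRat` (the bracket of `↥𝔤_tot(X; ℚ)` is the commutator),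
  **`mem_adDegree_totalLieAlgebraRat_iff`** (row A1-84's abstract degree-`q` part of `(𝔤_tot(X; ℚ), h)` IS row A1-75's
  `totalLieAlgebraRatDeg Φ q`), `isSl2Triple_totalLieAlgebraRat` (the triples `(e_η, h, f_η)` of row A1-81 are Mathlib
  `IsSl2Triple`s in `↥𝔤_tot(X; ℚ)`), `mem_lefschetzDomain_totalLieAlgebraRat` (every rational non-degenerate `η` puts
  `e_η` in the domain of `f` and `f_η` in its image), **`lieSubalgebra_eq_top_totalLieAlgebraRat`** (clause (ii) inside
  `↥𝔤_tot(X; ℚ)`: a Lie subalgebra containing `𝔤₂(ℚ)` and the `f_η` is everything, `g ≥ 2`);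
* **`isJordanLefschetzPair_totalLieAlgebraRat` — `(𝔤_tot(X; ℚ), h)` IS A JORDAN–LEFSCHETZ PAIR** (`g ≥ 2`), hence a
  Lefschetz pair with `h` simple (`isLefschetzPair_totalLieAlgebraRat`, `isSimpleElement_countingG_totalLieAlgebraRat`);
  read back through (2.2): `adDegree_totalLieAlgebraRat_eq_bot` (only the degrees `-2, 0, 2`, agreeing with row A1-75's
  `totalLieAlgebraRatDeg_eq_bot`), `existsUnique_isSl2Triple_totalLieAlgebraRat` (each Lefschetz element of `𝔤₂(ℚ)` has
  exactly one partner);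
* the same for an ABELIAN VARIETY (`hη₀ : IsRiemannForm Φ η₀` a polarisation; `h ∈ 𝔤_NS(X; ℚ)` is row A1-78's
  `IsRiemannForm.countingG_mem_neronSeveriLieAlgebraRat`): `IsRiemannForm.mem_adDegree_neronSeveriLieAlgebraRat_iff`, `IsRiemannForm.isSl2Triple_neronSeveriLieAlgebraRat`,
  **`IsRiemannForm.isJordanLefschetzPair_neronSeveriLieAlgebraRat` — `(𝔤_NS(X; ℚ), h)` IS A JORDAN–LEFSCHETZ PAIR ("The
  Néron–Severi Lie algebra of the abelian variety `X` is of Jordan type")**, `IsRiemannForm.isLefschetzPair_neronSeveriLieAlgebraRat`,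
  `IsRiemannForm.adDegree_neronSeveriLieAlgebraRat_eq_bot`;
* §3, every `g ≥ 1` and the ELLIPTIC CURVE: `linearIndependent_triple_totalLieAlgebraRat` (`h, e_η, f_η` are linearly
  independent, every `g`), `span_triple_totalLieAlgebraRat_eq_top_of_finrank_eq_one` /
  **`mem_totalLieAlgebraRat_iff_of_finrank_eq_one`** (`g = 1`: `𝔤_tot(X; ℚ) = ℚ h ⊕ ℚ e_η ⊕ ℚ f_η` for ANY rational
  non-degenerate `η` — `dim_ℚ = 3` is row A1-71), **`isJordanLefschetzPair_totalLieAlgebraRat_of_finrank_eq_one`** (the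
  elliptic curve: a Jordan–Lefschetz pair of type `(A₁, ∅)`, through row A1-84's `isJordanLefschetzPair_of_isSl2Triple`),
  **`isJordanLefschetzPair_totalLieAlgebraRat'`** (EVERY `g ≥ 1`), `isLefschetzPair_totalLieAlgebraRat'`,
  `adDegree_totalLieAlgebraRat_eq_bot'` ((2.2) read back for every `g ≥ 1`, extending row A1-75's vanishing to `g = 1`),
  `totalLieAlgebraRatDeg_two_eq_span_of_finrank_eq_one` / `…_zero_…` / `…_negTwo_…` (`g = 1`: `𝔤_tot(X; ℚ)₂ = ℚ e_η`,
  `𝔤₀ = ℚ h`, `𝔤₋₂ = ℚ f_η`, through row A1-84's §5–§6), `finrank_totalLieAlgebraRatDeg_of_finrank_eq_one` (`1 + 1 + 1`),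
  `toLieSubalgebra_eq_top_of_finrank_eq_one`, **`nonempty_lieEquiv_totalLieAlgebraRat_sl_two_of_finrank_eq_one`**
  (`𝔤_tot(X; ℚ) ≅ 𝔰𝔩₂(ℚ)`, "isomorphic to `𝔰𝔩(2)`" as printed) and `nonempty_lieEquiv_totalLieAlgebra_sl_two_of_finrank_eq_one`
  (`𝔤_tot(X; ℝ) ≅ 𝔰𝔩₂(ℝ)`, rows A1-51 + A1-78);
* §4, the POLARISED elliptic curve: **`IsRiemannForm.neronSeveriLieAlgebraRat_eq_totalLieAlgebraRat_of_finrank_eq_one`**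
  (`𝔤_NS(X; ℚ) = 𝔤_tot(X; ℚ)`), `IsRiemannForm.neronSeveriLieAlgebra_eq_totalLieAlgebra_of_finrank_eq_one`
  (`𝔤_NS(X; ℝ) = 𝔤_tot(X; ℝ)`, by `dim = 3 = dim`), `IsRiemannForm.nonempty_lieEquiv_neronSeveriLieAlgebraRat_sl_two_of_finrank_eq_one`,
  `IsAbelianVariety.neronSeveriLieAlgebraRat_eq_totalLieAlgebraRat_of_finrank_eq_one`;
* §5, the MODEL of the class `(A₁, ∅)`: `isSl2Triple_sl_two_std`, `exists_eq_smul_add_sl_two`,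
  **`isJordanLefschetzPair_sl_two`** (`(𝔰𝔩₂(K), H)` is a Jordan–Lefschetz pair, every field `K` of characteristic `0`),
  `finrank_sl_two_eq_three`, and
  **`exists_lieEquiv_sl_two_map_countingG_of_finrank_eq_one`** (the elliptic curve's pair is carried to the model by an
  isomorphism `e` with `e h = H`, rows A1-78 `Sl2Triple.equivSl` + A1-87 `IsJordanLefschetzPair.map`).

## SCOPE (what is NOT claimed)

(a) `g ≥ 2` for `𝔤_tot` in §1 (rows A1-75/A1-79/A1-82 describe the pieces through `𝔰𝔬(V_ℚ ⊕ V_ℚ^*)`); the elliptic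
curve (`𝔤_tot = 𝔰𝔩₂ = ℚ f_η ⊕ ℚ h ⊕ ℚ e_η`, `≅ 𝔰𝔩₂(ℚ)` resp. `𝔤_tot(X; ℝ) ≅ 𝔰𝔩₂(ℝ)` in existence form) is §3; the
isomorphisms are not given names as definitions here (row A1-78's `Sl2Triple.equivSl` is the explicit map).  (b) The abelian-variety statement assumes a polarisation `η₀` (a Riemann form);
for a non-algebraic torus `𝔤_NS` may be `0`.  (c) "a fundamental Jordan–Lefschetz MODULE of `H²(X, ℝ)`" (the module
side of (3.3)) is rows A1-45/A1-76/A1-80, not restated; the types `(D_{2n}, A_{2n-1})`, `(C_m, A_{m-1})`, … of (2.6)/(3.8)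
are not formalised.  (d) Nothing in this file is a case of the Hodge conjecture.

## References

* [LooijengaLunts1997] E. Looijenga, V. A. Lunts, *A Lie algebra attached to a projective variety*, Invent. Math. 129
  (1997) 361–412; arXiv:alg-geom/9604014. §1 p. 7, (1.9); §2 (2.1), (2.2); §3 (3.3), (3.6) (held
  `paper:arxiv-alg-geom_9604014`, p0006–p0007, p0009, p0013–p0014).
-/

noncomputable section

-- `Module ℚ` / `Module ℂ` synthesis on `E [⋀^Fin k]→L[ℝ] ℂ`, as in the parent files
set_option maxSynthPendingDepth 3

open Module Function

namespace Literature.Geometry.Kaehler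

namespace ComplexTorus

open Literature.LinearAlgebra.Alternating Literature.Algebra.Lie

/-! ### §1 `(𝔤_tot(X; ℚ), h)` is a Jordan–Lefschetz pair -/

section Total

variable {ι : Type*} [Fintype ι] [DecidableEq ι] {E : Type*} [NormedAddCommGroup E] [NormedSpace ℂ E]
  [FiniteDimensional ℂ E] [Nontrivial E] (Φ : (ι → ℝ) ≃L[ℝ] E)

omit [Fintype ι] [DecidableEq ι] [FiniteDimensional ℂ E] [Nontrivial E] in
/-- The bracket of the `ℚ`-Lie algebra `𝔤_tot(X; ℚ) ⊆ 𝔤𝔩_ℂ(H•(X; ℂ))` is the commutator of operators. [cite: LooijengaLunts1997, §1 (1.9)] -/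
theorem coe_lie_totalLieAlgebraRat (x y : totalLieAlgebraRat Φ) :
    ((⁅x, y⁆ : totalLieAlgebraRat Φ) : Module.End ℂ (GForm E ℂ)) =
      ⁅(x : Module.End ℂ (GForm E ℂ)), (y : Module.End ℂ (GForm E ℂ))⁆ := rfl

omit [Fintype ι] [DecidableEq ι] in
/-- **DICTIONARY: row A1-84's abstract `𝔤_q` of `(𝔤_tot(X; ℚ), h)` is row A1-75's `𝔤_tot(X; ℚ)_q`** — an element `x` of the
`ℚ`-Lie algebra `𝔤_tot(X; ℚ)` has `ad h`-degree `q` iff the operator `x` lies in `totalLieAlgebraRatDeg Φ q`.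
[cite: LooijengaLunts1997, §1 (1.1) ("u has degree k if and only if [h, u] = ku"), §3 (3.3)] -/
theorem mem_adDegree_totalLieAlgebraRat_iff {x : totalLieAlgebraRat Φ} {q : ℚ} :
    x ∈ adDegree ℚ (⟨countingG E, countingG_mem_totalLieAlgebraRat Φ⟩ : totalLieAlgebraRat Φ) q ↔
      (x : Module.End ℂ (GForm E ℂ)) ∈ totalLieAlgebraRatDeg Φ (q : ℝ) := by
  rw [mem_adDegree_iff, mem_totalLieAlgebraRatDeg_iff, Subtype.ext_iff]
  change ⁅countingG E, (x : Module.End ℂ (GForm E ℂ))⁆ = q • (x : Module.End ℂ (GForm E ℂ)) ↔ _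
  rw [← Rat.cast_smul_eq_qsmul (R := ℝ)]
  exact ⟨fun h ↦ ⟨x.2, h⟩, fun h ↦ h.2⟩

omit [Fintype ι] [DecidableEq ι] in
/-- In particular `x ∈ 𝔤₂` (abstract) iff `x ∈ 𝔤_tot(X; ℚ)₂` (row A1-75). [cite: LooijengaLunts1997, §3 (3.3)] -/
theorem mem_adDegree_two_totalLieAlgebraRat_iff {x : totalLieAlgebraRat Φ} :
    x ∈ adDegree ℚ (⟨countingG E, countingG_mem_totalLieAlgebraRat Φ⟩ : totalLieAlgebraRat Φ) 2 ↔
      (x : Module.End ℂ (GForm E ℂ)) ∈ totalLieAlgebraRatDeg Φ 2 := by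
  rw [mem_adDegree_totalLieAlgebraRat_iff, Rat.cast_ofNat]

/-- **The `𝔰𝔩₂`-triples `(e_η, h, f_η)` of row A1-81 are Mathlib `IsSl2Triple`s INSIDE `𝔤_tot(X; ℚ)`**, for every rational
non-degenerate `2`-form `η`. [cite: LooijengaLunts1997, §1 (1.1), §3 proof of (3.3)] -/
theorem isSl2Triple_totalLieAlgebraRat {η : E [⋀^Fin 2]→L[ℝ] ℝ} (hη : ofRealForm η ∈ rationalForms Φ 2)
    (hnd : ∀ v : E, v ≠ 0 → ∃ w : E, η ![v, w] ≠ 0) :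
    IsSl2Triple (⟨countingG E, countingG_mem_totalLieAlgebraRat Φ⟩ : totalLieAlgebraRat Φ)
      ⟨lefschetzG η, totalLieAlgebraRatDeg_le Φ 2 (lefschetzTriple_mem_totalLieAlgebraRatDeg Φ hη hnd).1.1⟩
      ⟨lefschetzDualG η, totalLieAlgebraRatDeg_le Φ (-2) (lefschetzTriple_mem_totalLieAlgebraRatDeg Φ hη hnd).1.2.2⟩ := by
  obtain ⟨-, hef, hhe, hhf⟩ := lefschetzTriple_mem_totalLieAlgebraRatDeg Φ hη hnd
  exact
    { h_ne_zero := fun h0 ↦ countingG_ne_zero (E := E) (by simpa using congrArg Subtype.val h0)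
      lie_e_f := Subtype.ext hef
      lie_h_e_nsmul := Subtype.ext hhe
      lie_h_f_nsmul := Subtype.ext hhf }

/-- **Every rational non-degenerate `η` puts `e_η` in the domain of `f` on `𝔞 = 𝔤₂` and `f_η` in the image of `f`.**
[cite: LooijengaLunts1997, §1 p. 7 ("for e in the domain of f, we have an 𝔰𝔩(2)-triple (e, h, f_e)"), §3 proof of (3.3)] -/
theorem mem_lefschetzDomain_totalLieAlgebraRat {η : E [⋀^Fin 2]→L[ℝ] ℝ} (hη : ofRealForm η ∈ rationalForms Φ 2)
    (hnd : ∀ v : E, v ≠ 0 → ∃ w : E, η ![v, w] ≠ 0) :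
    (⟨lefschetzG η, totalLieAlgebraRatDeg_le Φ 2 (lefschetzTriple_mem_totalLieAlgebraRatDeg Φ hη hnd).1.1⟩ :
        totalLieAlgebraRat Φ) ∈ lefschetzDomain ℚ (⟨countingG E, countingG_mem_totalLieAlgebraRat Φ⟩ : totalLieAlgebraRat Φ)
          (adDegree ℚ (⟨countingG E, countingG_mem_totalLieAlgebraRat Φ⟩ : totalLieAlgebraRat Φ) 2) ∧
      (⟨lefschetzDualG η, totalLieAlgebraRatDeg_le Φ (-2) (lefschetzTriple_mem_totalLieAlgebraRatDeg Φ hη hnd).1.2.2⟩ :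
        totalLieAlgebraRat Φ) ∈ lefschetzDuals ℚ (⟨countingG E, countingG_mem_totalLieAlgebraRat Φ⟩ : totalLieAlgebraRat Φ)
          (adDegree ℚ (⟨countingG E, countingG_mem_totalLieAlgebraRat Φ⟩ : totalLieAlgebraRat Φ) 2) :=
  mem_lefschetzDuals_of_isSl2Triple
    ((mem_adDegree_two_totalLieAlgebraRat_iff Φ).2 (lefschetzTriple_mem_totalLieAlgebraRatDeg Φ hη hnd).1.1)
    (isSl2Triple_totalLieAlgebraRat Φ hη hnd)

/-- **CLAUSE (ii) INSIDE `𝔤_tot(X; ℚ)`: a `ℚ`-Lie subalgebra of `𝔤_tot(X; ℚ)` containing `𝔤₂(ℚ)` and every `f_η` (`η`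
rational non-degenerate) is all of `𝔤_tot(X; ℚ)`** (`g ≥ 2`; row A1-79/A1-83's criterion
`mem_of_mem_totalLieAlgebraRat_of_forall_lie_mem`, read in the subtype: the `ℚ`-subspace of operators underlying the
subalgebra is commutator-closed because the bracket of `↥𝔤_tot(X; ℚ)` is the commutator). [cite: LooijengaLunts1997, §1 p. 7 ("(ii) 𝔤 is as a Lie algebra generated by 𝔞 and the image of f"), §3 proof of (3.3)] -/
theorem lieSubalgebra_eq_top_totalLieAlgebraRat (h2 : 2 ≤ finrank ℂ E) (S : LieSubalgebra ℚ (totalLieAlgebraRat Φ))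
    (h₂ : ∀ x : totalLieAlgebraRat Φ, (x : Module.End ℂ (GForm E ℂ)) ∈ totalLieAlgebraRatDeg Φ 2 → x ∈ S)
    (hf : ∀ (η : E [⋀^Fin 2]→L[ℝ] ℝ) (hη : ofRealForm η ∈ rationalForms Φ 2)
      (hnd : ∀ v : E, v ≠ 0 → ∃ w : E, η ![v, w] ≠ 0),
      (⟨lefschetzDualG η, totalLieAlgebraRatDeg_le Φ (-2) (lefschetzTriple_mem_totalLieAlgebraRatDeg Φ hη hnd).1.2.2⟩ :
        totalLieAlgebraRat Φ) ∈ S) :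
    S = ⊤ := by
  refine eq_top_iff.2 fun x _ ↦ ?_
  -- the `ℚ`-subspace of operators underlying `S` (the image of `S` under the coercion to operators)
  let K : Submodule ℚ (Module.End ℂ (GForm E ℂ)) :=
    { carrier := (fun z : totalLieAlgebraRat Φ ↦ (z : Module.End ℂ (GForm E ℂ))) '' (S : Set (totalLieAlgebraRat Φ))
      zero_mem' := ⟨_, S.zero_mem, rfl⟩
      add_mem' := by
        rintro _ _ ⟨a, ha, rfl⟩ ⟨b, hb, rfl⟩
        exact ⟨_, S.add_mem ha hb, rfl⟩
      smul_mem' := by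
        rintro q _ ⟨a, ha, rfl⟩
        exact ⟨_, S.smul_mem q ha, rfl⟩ }
  -- `K` is commutator-closed: the bracket of `↥𝔤_tot(X; ℚ)` is the commutator (`coe_lie_totalLieAlgebraRat`)
  have hK : ∀ P ∈ K, ∀ Q ∈ K, ⁅P, Q⁆ ∈ K := by
    rintro _ ⟨a, ha, rfl⟩ _ ⟨b, hb, rfl⟩
    exact ⟨⁅a, b⁆, S.lie_mem ha hb, coe_lie_totalLieAlgebraRat Φ a b⟩
  have h₂' : totalLieAlgebraRatDeg Φ 2 ≤ K := fun T hT ↦ ⟨⟨T, totalLieAlgebraRatDeg_le Φ 2 hT⟩, h₂ _ hT, rfl⟩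
  have hneg : totalLieAlgebraRatDeg Φ (-2) ≤ K :=
    totalLieAlgebraRatDeg_negTwo_le_of_forall_lefschetzDualG_mem Φ h2 fun θ hθ hθnd ↦ ⟨_, hf θ hθ hθnd, rfl⟩
  obtain ⟨z, hzS, hz⟩ := mem_of_mem_totalLieAlgebraRat_of_forall_lie_mem Φ h2 hK h₂' hneg x.2
  have hzx : z = x := Subtype.ext hz
  rw [← hzx]
  exact hzS

/-- **`(𝔤_tot(X; ℚ), h)` IS A JORDAN–LEFSCHETZ PAIR** for every complex torus `X` of dimension `g ≥ 2` — row A1-84's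
`IsJordanLefschetzPair ℚ h` for the `ℚ`-Lie algebra `𝔤_tot(X; ℚ)`: semisimple (row A1-71 `isSemisimple_totalLieAlgebraRat`),
`𝔞 = 𝔤₂(ℚ)` abelian (row A1-80), the domain of `f` non-empty (rows A1-81/A1-82: a rational non-degenerate `η` exists and
`(e_η, h, f_η)` is an `𝔰𝔩₂`-triple), and generated by `𝔤₂(ℚ)` and the `f_η` (rows A1-79/A1-82/A1-83
`mem_totalLieAlgebraRat_iff_forall_lefschetz_closed`). [cite: LooijengaLunts1997, §1 p. 7 (Lefschetz triples), §2 (2.1)–(2.2), §3 (3.3) ("a fundamental Jordan–Lefschetz module of H²(X, ℝ)")] -/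
theorem isJordanLefschetzPair_totalLieAlgebraRat (h2 : 2 ≤ finrank ℂ E) :
    IsJordanLefschetzPair ℚ (⟨countingG E, countingG_mem_totalLieAlgebraRat Φ⟩ : totalLieAlgebraRat Φ) := by
  obtain ⟨η, hη, hnd⟩ := exists_rational_nondegenerate_twoForm Φ
  refine ⟨isSemisimple_totalLieAlgebraRat Φ, le_rfl, fun x hx y hy ↦ ?_,
    ⟨_, (mem_lefschetzDomain_totalLieAlgebraRat Φ hη hnd).1⟩, ?_⟩
  · -- `𝔤₂(ℚ)` is abelian (row A1-80)
    exact Subtype.ext (lie_eq_zero_of_mem_totalLieAlgebraRatDeg_two' Φ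
      ((mem_adDegree_two_totalLieAlgebraRat_iff Φ).1 hx) ((mem_adDegree_two_totalLieAlgebraRat_iff Φ).1 hy))
  · -- generation (rows A1-79/A1-82/A1-83), through `lieSubalgebra_eq_top_totalLieAlgebraRat`
    exact lieSubalgebra_eq_top_totalLieAlgebraRat Φ h2 _
      (fun x hx ↦ LieSubalgebra.subset_lieSpan (Or.inl ((mem_adDegree_two_totalLieAlgebraRat_iff Φ).2 hx)))
      (fun η hη hnd ↦ LieSubalgebra.subset_lieSpan (Or.inr (mem_lefschetzDomain_totalLieAlgebraRat Φ hη hnd).2))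

/-- `(𝔤_tot(X; ℚ), h)` is a Lefschetz pair (`g ≥ 2`). [cite: LooijengaLunts1997, §1 p. 7, §3 (3.3)] -/
theorem isLefschetzPair_totalLieAlgebraRat (h2 : 2 ≤ finrank ℂ E) :
    IsLefschetzPair ℚ (⟨countingG E, countingG_mem_totalLieAlgebraRat Φ⟩ : totalLieAlgebraRat Φ) :=
  (isJordanLefschetzPair_totalLieAlgebraRat Φ h2).isLefschetzPair

/-- `h` is a simple element of `𝔤_tot(X; ℚ)` (every torus of positive dimension: some rational non-degenerate `η` exists).
[cite: LooijengaLunts1997, §1 p. 7 ("a simple element h ∈ 𝔤 (in the sense of appearing as the middle element of an 𝔰𝔩₂-triple)")] -/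
theorem isSimpleElement_countingG_totalLieAlgebraRat :
    IsSimpleElement (⟨countingG E, countingG_mem_totalLieAlgebraRat Φ⟩ : totalLieAlgebraRat Φ) := by
  obtain ⟨η, hη, hnd⟩ := exists_rational_nondegenerate_twoForm Φ
  exact ⟨_, _, isSl2Triple_totalLieAlgebraRat Φ hη hnd⟩

/-- **(2.2) READ BACK: `𝔤_tot(X; ℚ)` has only the `ad h`-degrees `-2, 0, 2`** (`g ≥ 2`) — obtained here from the ABSTRACT
Proposition (2.2) of row A1-84 applied to the Jordan–Lefschetz pair `(𝔤_tot(X; ℚ), h)`; row A1-75's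
`totalLieAlgebraRatDeg_eq_bot` proved the same from the explicit `𝔰𝔬(V_ℚ ⊕ V_ℚ^*)`-description, and the two agree.
[cite: LooijengaLunts1997, §2 (2.2) ("𝔤 = 𝔤₋₂ ⊕ 𝔤₀ ⊕ 𝔤₂"), §3 (3.3)] -/
theorem adDegree_totalLieAlgebraRat_eq_bot (h2 : 2 ≤ finrank ℂ E) {q : ℚ} (hq₁ : q ≠ -2) (hq₂ : q ≠ 0) (hq₃ : q ≠ 2) :
    adDegree ℚ (⟨countingG E, countingG_mem_totalLieAlgebraRat Φ⟩ : totalLieAlgebraRat Φ) q = ⊥ ∧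
      totalLieAlgebraRatDeg Φ (q : ℝ) = ⊥ :=
  ⟨(isJordanLefschetzPair_totalLieAlgebraRat Φ h2).adDegree_eq_bot hq₁ hq₂ hq₃,
    totalLieAlgebraRatDeg_eq_bot Φ h2 (by exact_mod_cast hq₁) (by exact_mod_cast hq₂) (by exact_mod_cast hq₃)⟩

omit [DecidableEq ι] in
/-- **"This `f` is then unique" in `𝔤_tot(X; ℚ)`**: every Lefschetz element of `𝔤₂(ℚ)` has exactly one `𝔰𝔩₂`-partner in
`𝔤_tot(X; ℚ)` (row A1-84's `existsUnique_of_mem_lefschetzDomain`; in particular the partner of `e_η` is `f_η`).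
[cite: LooijengaLunts1997, §1 (1.1) p. 4 ("This f is then unique")] -/
theorem existsUnique_isSl2Triple_totalLieAlgebraRat {e : totalLieAlgebraRat Φ}
    (he : e ∈ lefschetzDomain ℚ (⟨countingG E, countingG_mem_totalLieAlgebraRat Φ⟩ : totalLieAlgebraRat Φ)
      (adDegree ℚ (⟨countingG E, countingG_mem_totalLieAlgebraRat Φ⟩ : totalLieAlgebraRat Φ) 2)) :
    ∃! f : totalLieAlgebraRat Φ, IsSl2Triple (⟨countingG E, countingG_mem_totalLieAlgebraRat Φ⟩ : totalLieAlgebraRat Φ) e f :=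
  existsUnique_of_mem_lefschetzDomain he

end Total

/-! ### §2 `(𝔤_NS(X; ℚ), h)` is a Jordan–Lefschetz pair for an abelian variety ("of Jordan type", (3.6)) -/

section NeronSeveri

variable {ι : Type*} [Fintype ι] [DecidableEq ι] {E : Type*} [NormedAddCommGroup E] [NormedSpace ℂ E]
  [FiniteDimensional ℂ E] [Nontrivial E] (Φ : (ι → ℝ) ≃L[ℝ] E) {η₀ : E [⋀^Fin 2]→L[ℝ] ℝ} (hη₀ : IsRiemannForm Φ η₀)
include hη₀

-- (`h ∈ 𝔤_NS(X; ℚ)` for a polarised torus is row A1-78's `IsRiemannForm.countingG_mem_neronSeveriLieAlgebraRat`.)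

omit [Fintype ι] [DecidableEq ι] [FiniteDimensional ℂ E] [Nontrivial E] hη₀ in
/-- The bracket of the `ℚ`-Lie algebra `𝔤_NS(X; ℚ)` is the commutator of operators. [cite: LooijengaLunts1997, §1 (1.9)] -/
theorem coe_lie_neronSeveriLieAlgebraRat (x y : neronSeveriLieAlgebraRat Φ) :
    ((⁅x, y⁆ : neronSeveriLieAlgebraRat Φ) : Module.End ℂ (GForm E ℂ)) =
      ⁅(x : Module.End ℂ (GForm E ℂ)), (y : Module.End ℂ (GForm E ℂ))⁆ := rfl

/-- **DICTIONARY: the abstract `𝔤_q` of `(𝔤_NS(X; ℚ), h)` is row A1-69's `𝔤_NS(X; ℚ)_q`.** [cite: LooijengaLunts1997, §1 (1.1), §3 (3.6)] -/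
theorem IsRiemannForm.mem_adDegree_neronSeveriLieAlgebraRat_iff {x : neronSeveriLieAlgebraRat Φ} {q : ℚ} :
    x ∈ adDegree ℚ (⟨countingG E, hη₀.countingG_mem_neronSeveriLieAlgebraRat Φ⟩ : neronSeveriLieAlgebraRat Φ) q ↔
      (x : Module.End ℂ (GForm E ℂ)) ∈ neronSeveriLieAlgebraRatDeg Φ (q : ℝ) := by
  rw [mem_adDegree_iff, mem_neronSeveriLieAlgebraRatDeg_iff, Subtype.ext_iff]
  change ⁅countingG E, (x : Module.End ℂ (GForm E ℂ))⁆ = q • (x : Module.End ℂ (GForm E ℂ)) ↔ _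
  rw [← Rat.cast_smul_eq_qsmul (R := ℝ)]
  exact ⟨fun h ↦ ⟨x.2, h⟩, fun h ↦ h.2⟩

/-- In particular `x ∈ 𝔤₂` (abstract) iff `x ∈ 𝔤_NS(X; ℚ)₂` (row A1-69). [cite: LooijengaLunts1997, §3 (3.6)] -/
theorem IsRiemannForm.mem_adDegree_two_neronSeveriLieAlgebraRat_iff {x : neronSeveriLieAlgebraRat Φ} :
    x ∈ adDegree ℚ (⟨countingG E, hη₀.countingG_mem_neronSeveriLieAlgebraRat Φ⟩ : neronSeveriLieAlgebraRat Φ) 2 ↔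
      (x : Module.End ℂ (GForm E ℂ)) ∈ neronSeveriLieAlgebraRatDeg Φ 2 := by
  rw [hη₀.mem_adDegree_neronSeveriLieAlgebraRat_iff, Rat.cast_ofNat]

/-- **The `𝔰𝔩₂`-triples `(e_θ, h, f_θ)`, `θ ∈ NS_ℚ(X)` non-degenerate, INSIDE `𝔤_NS(X; ℚ)`.** [cite: LooijengaLunts1997, §1 (1.1), §3 (3.5)–(3.6)] -/
theorem IsRiemannForm.isSl2Triple_neronSeveriLieAlgebraRat {θ : E [⋀^Fin 2]→L[ℝ] ℝ} (hθ : θ ∈ neronSeveriQ Φ)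
    (hnd : ∀ v : E, v ≠ 0 → ∃ w : E, θ ![v, w] ≠ 0) :
    IsSl2Triple (⟨countingG E, hη₀.countingG_mem_neronSeveriLieAlgebraRat Φ⟩ : neronSeveriLieAlgebraRat Φ)
      ⟨lefschetzG θ, neronSeveriLieAlgebraRatDeg_le Φ 2 (lefschetzG_mem_neronSeveriLieAlgebraRatDeg_two Φ hθ)⟩
      ⟨lefschetzDualG θ, neronSeveriLieAlgebraRatDeg_le Φ (-2)
        (lefschetzDualG_mem_neronSeveriLieAlgebraRatDeg_negTwo Φ hθ hnd)⟩ := by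
  obtain ⟨-, hef, hhe, hhf⟩ :=
    lefschetzTriple_mem_totalLieAlgebraRatDeg Φ (ofRealForm_mem_rationalForms_of_mem_neronSeveriQ Φ hθ) hnd
  exact
    { h_ne_zero := fun h0 ↦ countingG_ne_zero (E := E) (by simpa using congrArg Subtype.val h0)
      lie_e_f := Subtype.ext hef
      lie_h_e_nsmul := Subtype.ext hhe
      lie_h_f_nsmul := Subtype.ext hhf }

/-- Every non-degenerate `θ ∈ NS_ℚ(X)` puts `e_θ` in the domain of `f` on `𝔞 = 𝔤_NS(X; ℚ)₂` and `f_θ` in the image of `f`;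
in particular the polarisation `η₀` does. [cite: LooijengaLunts1997, §1 p. 7, §3 (3.6)] -/
theorem IsRiemannForm.mem_lefschetzDomain_neronSeveriLieAlgebraRat {θ : E [⋀^Fin 2]→L[ℝ] ℝ} (hθ : θ ∈ neronSeveriQ Φ)
    (hnd : ∀ v : E, v ≠ 0 → ∃ w : E, θ ![v, w] ≠ 0) :
    (⟨lefschetzG θ, neronSeveriLieAlgebraRatDeg_le Φ 2 (lefschetzG_mem_neronSeveriLieAlgebraRatDeg_two Φ hθ)⟩ :
        neronSeveriLieAlgebraRat Φ) ∈
        lefschetzDomain ℚ (⟨countingG E, hη₀.countingG_mem_neronSeveriLieAlgebraRat Φ⟩ : neronSeveriLieAlgebraRat Φ)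
          (adDegree ℚ (⟨countingG E, hη₀.countingG_mem_neronSeveriLieAlgebraRat Φ⟩ : neronSeveriLieAlgebraRat Φ) 2) ∧
      (⟨lefschetzDualG θ, neronSeveriLieAlgebraRatDeg_le Φ (-2)
          (lefschetzDualG_mem_neronSeveriLieAlgebraRatDeg_negTwo Φ hθ hnd)⟩ : neronSeveriLieAlgebraRat Φ) ∈
        lefschetzDuals ℚ (⟨countingG E, hη₀.countingG_mem_neronSeveriLieAlgebraRat Φ⟩ : neronSeveriLieAlgebraRat Φ)
          (adDegree ℚ (⟨countingG E, hη₀.countingG_mem_neronSeveriLieAlgebraRat Φ⟩ : neronSeveriLieAlgebraRat Φ) 2) :=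
  mem_lefschetzDuals_of_isSl2Triple
    ((hη₀.mem_adDegree_two_neronSeveriLieAlgebraRat_iff Φ).2 (lefschetzG_mem_neronSeveriLieAlgebraRatDeg_two Φ hθ))
    (hη₀.isSl2Triple_neronSeveriLieAlgebraRat Φ hθ hnd)

/-- **`(𝔤_NS(X; ℚ), h)` IS A JORDAN–LEFSCHETZ PAIR for an abelian variety** ("The Néron–Severi Lie algebra of the abelian
variety `X` is of Jordan type", (3.6)) — row A1-84's `IsJordanLefschetzPair ℚ h` for the `ℚ`-Lie algebra `𝔤_NS(X; ℚ)`: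
semisimple (row A1-70 `IsRiemannForm.isSemisimple_neronSeveriLieAlgebraRat`), `𝔞 = 𝔤_NS(X; ℚ)₂ = e(NS_ℚ(X))` abelian
(row A1-69 `IsRiemannForm.range_lefschetzGRat`), the polarisation in the domain of `f`, and `𝔤_NS(X; ℚ)` spanned over `ℚ` by
the `e_η`, `f_θ`, `[e_η, f_θ]` (row A1-69 `IsRiemannForm.neronSeveriLieAlgebraRat_toSubmodule_eq_span_rat`) — so generated
as a Lie algebra by `𝔤₂(ℚ)` and the `f_θ`. [cite: LooijengaLunts1997, §3 (3.6) ("The Néron–Severi Lie algebra of the abelian variety X is of Jordan type"), §1 p. 7, §2 (2.1)–(2.2)] -/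
theorem IsRiemannForm.isJordanLefschetzPair_neronSeveriLieAlgebraRat :
    IsJordanLefschetzPair ℚ (⟨countingG E, hη₀.countingG_mem_neronSeveriLieAlgebraRat Φ⟩ : neronSeveriLieAlgebraRat Φ) := by
  have hη : η₀ ∈ neronSeveriQ Φ := mem_neronSeveriQ_of_isRiemannForm Φ hη₀
  have hnd₀ := nondegenerate_of_pos hη₀.2.2
  refine ⟨hη₀.isSemisimple_neronSeveriLieAlgebraRat Φ, le_rfl, fun x hx y hy ↦ ?_,
    ⟨_, (hη₀.mem_lefschetzDomain_neronSeveriLieAlgebraRat Φ hη hnd₀).1⟩, ?_⟩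
  · -- `𝔤_NS(X; ℚ)₂ = e(NS_ℚ(X))` is abelian
    have hx' := (hη₀.mem_adDegree_two_neronSeveriLieAlgebraRat_iff Φ).1 hx
    have hy' := (hη₀.mem_adDegree_two_neronSeveriLieAlgebraRat_iff Φ).1 hy
    rw [← hη₀.range_lefschetzGRat Φ] at hx' hy'
    obtain ⟨a, ha⟩ := hx'
    obtain ⟨b, hb⟩ := hy'
    refine Subtype.ext ?_
    rw [coe_lie_neronSeveriLieAlgebraRat, ← ha, ← hb, lefschetzGRat_apply, lefschetzGRat_apply]
    exact lie_lefschetzG_lefschetzG _ _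
  · -- generation: `𝔤_NS(X; ℚ) = span_ℚ {e_η, f_θ, [e_η, f_θ]}` and each generator lies in `lieSpan (𝔤₂ ∪ f(dom f))`
    refine eq_top_iff.2 fun x _ ↦ ?_
    set S := LieSubalgebra.lieSpan ℚ (neronSeveriLieAlgebraRat Φ)
      ((adDegree ℚ (⟨countingG E, hη₀.countingG_mem_neronSeveriLieAlgebraRat Φ⟩ : neronSeveriLieAlgebraRat Φ) 2 :
          Set (neronSeveriLieAlgebraRat Φ)) ∪
        lefschetzDuals ℚ (⟨countingG E, hη₀.countingG_mem_neronSeveriLieAlgebraRat Φ⟩ : neronSeveriLieAlgebraRat Φ)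
          (adDegree ℚ (⟨countingG E, hη₀.countingG_mem_neronSeveriLieAlgebraRat Φ⟩ : neronSeveriLieAlgebraRat Φ) 2))
    have hle : ∀ {T : Module.End ℂ (GForm E ℂ)}, T ∈ Submodule.span ℚ (neronSeveriRatGens Φ) →
        T ∈ neronSeveriLieAlgebraRat Φ := fun hT ↦ by
      rw [← hη₀.neronSeveriLieAlgebraRat_toSubmodule_eq_span_rat Φ] at hT; exact hT
    have hx : (x : Module.End ℂ (GForm E ℂ)) ∈ Submodule.span ℚ (neronSeveriRatGens Φ) := by
      rw [← hη₀.neronSeveriLieAlgebraRat_toSubmodule_eq_span_rat Φ]; exact x.2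
    -- every element of the span that lies in `𝔤_NS(X; ℚ)` is in `S`
    suffices key : ∀ T ∈ Submodule.span ℚ (neronSeveriRatGens Φ), ∀ hT : T ∈ neronSeveriLieAlgebraRat Φ,
        (⟨T, hT⟩ : neronSeveriLieAlgebraRat Φ) ∈ S from key _ hx x.2
    intro T hT
    refine Submodule.span_induction (p := fun T _ ↦ ∀ hT : T ∈ neronSeveriLieAlgebraRat Φ,
      (⟨T, hT⟩ : neronSeveriLieAlgebraRat Φ) ∈ S) ?_ ?_ ?_ ?_ hT
    · rintro T (⟨η, hη', rfl⟩ | ⟨θ, hθ, hθnd, rfl⟩ | ⟨η, hη', θ, hθ, hθnd, rfl⟩) hT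
      · exact LieSubalgebra.subset_lieSpan (Or.inl ((hη₀.mem_adDegree_two_neronSeveriLieAlgebraRat_iff Φ).2
          (lefschetzG_mem_neronSeveriLieAlgebraRatDeg_two Φ hη')))
      · exact LieSubalgebra.subset_lieSpan (Or.inr (hη₀.mem_lefschetzDomain_neronSeveriLieAlgebraRat Φ hθ hθnd).2)
      · have h1 : (⟨⁅lefschetzG η, lefschetzDualG θ⁆, hT⟩ : neronSeveriLieAlgebraRat Φ) =
            ⁅(⟨lefschetzG η, neronSeveriLieAlgebraRatDeg_le Φ 2 (lefschetzG_mem_neronSeveriLieAlgebraRatDeg_two Φ hη')⟩ :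
                neronSeveriLieAlgebraRat Φ),
              (⟨lefschetzDualG θ, neronSeveriLieAlgebraRatDeg_le Φ (-2)
                (lefschetzDualG_mem_neronSeveriLieAlgebraRatDeg_negTwo Φ hθ hθnd)⟩ : neronSeveriLieAlgebraRat Φ)⁆ :=
          Subtype.ext rfl
        rw [h1]
        exact S.lie_mem
          (LieSubalgebra.subset_lieSpan (Or.inl ((hη₀.mem_adDegree_two_neronSeveriLieAlgebraRat_iff Φ).2
            (lefschetzG_mem_neronSeveriLieAlgebraRatDeg_two Φ hη'))))
          (LieSubalgebra.subset_lieSpan (Or.inr (hη₀.mem_lefschetzDomain_neronSeveriLieAlgebraRat Φ hθ hθnd).2))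
    · intro hT
      exact S.zero_mem
    · intro T T' hTs hT's ihT ihT' hTT'
      exact S.add_mem (ihT (hle hTs)) (ihT' (hle hT's))
    · intro q T hTs ih hqT
      exact S.smul_mem q (ih (hle hTs))

/-- `(𝔤_NS(X; ℚ), h)` is a Lefschetz pair (abelian variety). [cite: LooijengaLunts1997, §1 p. 7, §3 (3.6)] -/
theorem IsRiemannForm.isLefschetzPair_neronSeveriLieAlgebraRat :
    IsLefschetzPair ℚ (⟨countingG E, hη₀.countingG_mem_neronSeveriLieAlgebraRat Φ⟩ : neronSeveriLieAlgebraRat Φ) :=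
  (hη₀.isJordanLefschetzPair_neronSeveriLieAlgebraRat Φ).isLefschetzPair

/-- **(2.2) READ BACK for the abelian variety: `𝔤_NS(X; ℚ)` has only the `ad h`-degrees `-2, 0, 2`** — the abstract
`𝔤_q = 0` of row A1-84's Proposition (2.2) applied to the Jordan–Lefschetz pair `(𝔤_NS(X; ℚ), h)`, next to row A1-69's
`IsRiemannForm.neronSeveriLieAlgebraRatDeg_eq_bot` (the same vanishing from the explicit projections); the two agree.
[cite: LooijengaLunts1997, §2 (2.2), §3 (3.6)] -/
theorem IsRiemannForm.adDegree_neronSeveriLieAlgebraRat_eq_bot {q : ℚ} (hq₁ : q ≠ -2) (hq₂ : q ≠ 0) (hq₃ : q ≠ 2) :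
    adDegree ℚ (⟨countingG E, hη₀.countingG_mem_neronSeveriLieAlgebraRat Φ⟩ : neronSeveriLieAlgebraRat Φ) q = ⊥ ∧
      neronSeveriLieAlgebraRatDeg Φ (q : ℝ) = ⊥ :=
  ⟨(hη₀.isJordanLefschetzPair_neronSeveriLieAlgebraRat Φ).adDegree_eq_bot hq₁ hq₂ hq₃,
    hη₀.neronSeveriLieAlgebraRatDeg_eq_bot Φ (by exact_mod_cast hq₁) (by exact_mod_cast hq₂) (by exact_mod_cast hq₃)⟩

end NeronSeveri

/-! ### §3 Every dimension `g ≥ 1`; the elliptic curve: `(𝔤_tot(X; ℚ), h) ≅ (𝔰𝔩₂(ℚ), h)`, type `(A₁, ∅)` of (2.6) -/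

section EveryDimension

variable {ι : Type*} [Fintype ι] [DecidableEq ι] {E : Type*} [NormedAddCommGroup E] [NormedSpace ℂ E]
  [FiniteDimensional ℂ E] [Nontrivial E] (Φ : (ι → ℝ) ≃L[ℝ] E)

/-- **`h, e_η, f_η` are linearly independent in `𝔤_tot(X; ℚ)`**, for every `g` and every rational non-degenerate `η`
(row A1-78's generic `Sl2Triple.linearIndependent_triple`, re-indexed to the order `(h, e, f)`).
[cite: LooijengaLunts1997, §1 (1.1) p. 4 ("(e, h, f) is a 𝔰𝔩(2)-triple"), §3 (3.3)] -/
theorem linearIndependent_triple_totalLieAlgebraRat {η : E [⋀^Fin 2]→L[ℝ] ℝ} (hη : ofRealForm η ∈ rationalForms Φ 2)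
    (hnd : ∀ v : E, v ≠ 0 → ∃ w : E, η ![v, w] ≠ 0) :
    LinearIndependent ℚ ![(⟨countingG E, countingG_mem_totalLieAlgebraRat Φ⟩ : totalLieAlgebraRat Φ),
      ⟨lefschetzG η, totalLieAlgebraRatDeg_le Φ 2 (lefschetzTriple_mem_totalLieAlgebraRatDeg Φ hη hnd).1.1⟩,
      ⟨lefschetzDualG η, totalLieAlgebraRatDeg_le Φ (-2) (lefschetzTriple_mem_totalLieAlgebraRatDeg Φ hη hnd).1.2.2⟩] := by
  have hperm : ![(⟨countingG E, countingG_mem_totalLieAlgebraRat Φ⟩ : totalLieAlgebraRat Φ),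
      ⟨lefschetzG η, totalLieAlgebraRatDeg_le Φ 2 (lefschetzTriple_mem_totalLieAlgebraRatDeg Φ hη hnd).1.1⟩,
      ⟨lefschetzDualG η, totalLieAlgebraRatDeg_le Φ (-2) (lefschetzTriple_mem_totalLieAlgebraRatDeg Φ hη hnd).1.2.2⟩] =
      ![(⟨lefschetzG η, totalLieAlgebraRatDeg_le Φ 2 (lefschetzTriple_mem_totalLieAlgebraRatDeg Φ hη hnd).1.1⟩ :
          totalLieAlgebraRat Φ),
        ⟨lefschetzDualG η, totalLieAlgebraRatDeg_le Φ (-2) (lefschetzTriple_mem_totalLieAlgebraRatDeg Φ hη hnd).1.2.2⟩,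
        ⟨countingG E, countingG_mem_totalLieAlgebraRat Φ⟩] ∘ ![(2 : Fin 3), 0, 1] := by
    funext i; fin_cases i <;> rfl
  rw [hperm]
  exact (Sl2Triple.linearIndependent_triple ℚ (isSl2Triple_totalLieAlgebraRat Φ hη hnd)).comp _ (by decide)

/-- **`g = 1`: `h, e_η, f_η` form a BASIS of `𝔤_tot(X; ℚ)`** — linearly independent and `dim_ℚ 𝔤_tot(X; ℚ) = 3` (row
A1-71 `finrank_totalLieAlgebraRat_of_finrank_eq_one`), so they span. [cite: LooijengaLunts1997, Introduction p. 2, §1 (1.9), §2 (2.6) (case (A₁, ∅), m = 1)] -/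
theorem span_triple_totalLieAlgebraRat_eq_top_of_finrank_eq_one (h1 : finrank ℂ E = 1) {η : E [⋀^Fin 2]→L[ℝ] ℝ}
    (hη : ofRealForm η ∈ rationalForms Φ 2) (hnd : ∀ v : E, v ≠ 0 → ∃ w : E, η ![v, w] ≠ 0) :
    Submodule.span ℚ (Set.range ![(⟨countingG E, countingG_mem_totalLieAlgebraRat Φ⟩ : totalLieAlgebraRat Φ),
      ⟨lefschetzG η, totalLieAlgebraRatDeg_le Φ 2 (lefschetzTriple_mem_totalLieAlgebraRatDeg Φ hη hnd).1.1⟩,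
      ⟨lefschetzDualG η, totalLieAlgebraRatDeg_le Φ (-2) (lefschetzTriple_mem_totalLieAlgebraRatDeg Φ hη hnd).1.2.2⟩]) = ⊤ :=
  (linearIndependent_triple_totalLieAlgebraRat Φ hη hnd).span_eq_top_of_card_eq_finrank
    (by rw [Fintype.card_fin, finrank_totalLieAlgebraRat_of_finrank_eq_one Φ h1])

/-- **`g = 1`: every element of `𝔤_tot(X; ℚ)` is `a h + b e_η + c f_η`** (`a, b, c ∈ ℚ`). [cite: LooijengaLunts1997, Introduction p. 2 ("e_κ, h, f_κ make up a Lie subalgebra … isomorphic to 𝔰𝔩(2)"), §2 (2.6) (m = 1)] -/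
theorem exists_eq_smul_add_of_finrank_eq_one (h1 : finrank ℂ E = 1) {η : E [⋀^Fin 2]→L[ℝ] ℝ}
    (hη : ofRealForm η ∈ rationalForms Φ 2) (hnd : ∀ v : E, v ≠ 0 → ∃ w : E, η ![v, w] ≠ 0)
    {T : Module.End ℂ (GForm E ℂ)} (hT : T ∈ totalLieAlgebraRat Φ) :
    ∃ a b c : ℚ, T = a • countingG E + b • lefschetzG η + c • lefschetzDualG η := by
  have hx : (⟨T, hT⟩ : totalLieAlgebraRat Φ) ∈ Submodule.span ℚ (Set.range
      ![(⟨countingG E, countingG_mem_totalLieAlgebraRat Φ⟩ : totalLieAlgebraRat Φ),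
        ⟨lefschetzG η, totalLieAlgebraRatDeg_le Φ 2 (lefschetzTriple_mem_totalLieAlgebraRatDeg Φ hη hnd).1.1⟩,
        ⟨lefschetzDualG η, totalLieAlgebraRatDeg_le Φ (-2) (lefschetzTriple_mem_totalLieAlgebraRatDeg Φ hη hnd).1.2.2⟩]) := by
    rw [span_triple_totalLieAlgebraRat_eq_top_of_finrank_eq_one Φ h1 hη hnd]
    exact Submodule.mem_top
  obtain ⟨c, hc⟩ := (Submodule.mem_span_range_iff_exists_fun ℚ).1 hx
  rw [Fin.sum_univ_three] at hc
  exact ⟨c 0, c 1, c 2, (congrArg Subtype.val hc).symm⟩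

/-- Conversely `a h + b e_η + c f_η ∈ 𝔤_tot(X; ℚ)` (every `g`). [cite: LooijengaLunts1997, §1 (1.9), §3 (3.3)] -/
theorem smul_add_mem_totalLieAlgebraRat {η : E [⋀^Fin 2]→L[ℝ] ℝ} (hη : ofRealForm η ∈ rationalForms Φ 2)
    (hnd : ∀ v : E, v ≠ 0 → ∃ w : E, η ![v, w] ≠ 0) (a b c : ℚ) :
    a • countingG E + b • lefschetzG η + c • lefschetzDualG η ∈ totalLieAlgebraRat Φ := by
  obtain ⟨⟨he, hh, hf⟩, -⟩ := lefschetzTriple_mem_totalLieAlgebraRatDeg Φ hη hnd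
  exact Submodule.add_mem _ (Submodule.add_mem _ (Submodule.smul_mem _ a (totalLieAlgebraRatDeg_le Φ 0 hh))
    (Submodule.smul_mem _ b (totalLieAlgebraRatDeg_le Φ 2 he))) (Submodule.smul_mem _ c (totalLieAlgebraRatDeg_le Φ (-2) hf))

/-- **`g = 1`: `𝔤_tot(X; ℚ) = ℚ h ⊕ ℚ e_η ⊕ ℚ f_η`** as a membership criterion. [cite: LooijengaLunts1997, Introduction p. 2, §1 (1.9), §2 (2.6) (m = 1)] -/
theorem mem_totalLieAlgebraRat_iff_of_finrank_eq_one (h1 : finrank ℂ E = 1) {η : E [⋀^Fin 2]→L[ℝ] ℝ}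
    (hη : ofRealForm η ∈ rationalForms Φ 2) (hnd : ∀ v : E, v ≠ 0 → ∃ w : E, η ![v, w] ≠ 0)
    {T : Module.End ℂ (GForm E ℂ)} :
    T ∈ totalLieAlgebraRat Φ ↔ ∃ a b c : ℚ, T = a • countingG E + b • lefschetzG η + c • lefschetzDualG η := by
  refine ⟨exists_eq_smul_add_of_finrank_eq_one Φ h1 hη hnd, ?_⟩
  rintro ⟨a, b, c, rfl⟩
  exact smul_add_mem_totalLieAlgebraRat Φ hη hnd a b c

/-- **THE ELLIPTIC CURVE: `(𝔤_tot(X; ℚ), h)` IS A JORDAN–LEFSCHETZ PAIR for `g = 1`** — `𝔤_tot(X; ℚ)` is semisimple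
(row A1-71) and spanned by the `𝔰𝔩₂`-triple `(e_η, h, f_η)`, so row A1-84's `isJordanLefschetzPair_of_isSl2Triple`
applies: the type `(A₁, ∅)` (`m = 1` of `(A_{2m-1}, A_{m-1} + A_{m-1})`) of the classification (2.6).
[cite: LooijengaLunts1997, Introduction p. 2 ("e_κ, h, f_κ make up a Lie subalgebra 𝔤_κ of 𝔤𝔩(H(X)) isomorphic to 𝔰𝔩(2)"), §1 (1.1) p. 4, p. 7, §2 (2.6) (m = 1)] -/
theorem isJordanLefschetzPair_totalLieAlgebraRat_of_finrank_eq_one (h1 : finrank ℂ E = 1) :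
    IsJordanLefschetzPair ℚ (⟨countingG E, countingG_mem_totalLieAlgebraRat Φ⟩ : totalLieAlgebraRat Φ) := by
  obtain ⟨η, hη, hnd⟩ := exists_rational_nondegenerate_twoForm Φ
  haveI := isSemisimple_totalLieAlgebraRat Φ
  refine isJordanLefschetzPair_of_isSl2Triple (isSl2Triple_totalLieAlgebraRat Φ hη hnd) fun x ↦ ?_
  obtain ⟨a, b, c, hx⟩ := exists_eq_smul_add_of_finrank_eq_one Φ h1 hη hnd x.2
  exact ⟨a, b, c, Subtype.ext hx⟩

/-- **EVERY COMPLEX TORUS OF POSITIVE DIMENSION: `(𝔤_tot(X; ℚ), h)` IS A JORDAN–LEFSCHETZ PAIR** (`g ≥ 2`: §1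
`isJordanLefschetzPair_totalLieAlgebraRat`; `g = 1`: the elliptic curve above). [cite: LooijengaLunts1997, §1 p. 7, §2 (2.1)–(2.2), §3 (3.3)] -/
theorem isJordanLefschetzPair_totalLieAlgebraRat' :
    IsJordanLefschetzPair ℚ (⟨countingG E, countingG_mem_totalLieAlgebraRat Φ⟩ : totalLieAlgebraRat Φ) := by
  obtain h1 | h2 : finrank ℂ E = 1 ∨ 2 ≤ finrank ℂ E := by
    have := Module.finrank_pos (R := ℂ) (M := E)
    omega
  · exact isJordanLefschetzPair_totalLieAlgebraRat_of_finrank_eq_one Φ h1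
  · exact isJordanLefschetzPair_totalLieAlgebraRat Φ h2

/-- `(𝔤_tot(X; ℚ), h)` is a Lefschetz pair, every `g ≥ 1`. [cite: LooijengaLunts1997, §1 p. 7, §3 (3.3)] -/
theorem isLefschetzPair_totalLieAlgebraRat' :
    IsLefschetzPair ℚ (⟨countingG E, countingG_mem_totalLieAlgebraRat Φ⟩ : totalLieAlgebraRat Φ) :=
  (isJordanLefschetzPair_totalLieAlgebraRat' Φ).isLefschetzPair

/-- **(2.2) for every `g ≥ 1`: `𝔤_tot(X; ℚ)` has only the `ad h`-degrees `-2, 0, 2`** — the abstract `𝔤_q = 0` AND row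
A1-75's `totalLieAlgebraRatDeg Φ q = 0` for `q ∉ {-2, 0, 2}` (row A1-75 proved the latter for `g ≥ 2` only).
[cite: LooijengaLunts1997, §2 (2.2), §3 (3.3)] -/
theorem adDegree_totalLieAlgebraRat_eq_bot' {q : ℚ} (hq₁ : q ≠ -2) (hq₂ : q ≠ 0) (hq₃ : q ≠ 2) :
    adDegree ℚ (⟨countingG E, countingG_mem_totalLieAlgebraRat Φ⟩ : totalLieAlgebraRat Φ) q = ⊥ ∧
      totalLieAlgebraRatDeg Φ (q : ℝ) = ⊥ := by
  have h := (isJordanLefschetzPair_totalLieAlgebraRat' Φ).adDegree_eq_bot hq₁ hq₂ hq₃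
  refine ⟨h, eq_bot_iff.2 fun T hT ↦ ?_⟩
  have hT' : (⟨T, totalLieAlgebraRatDeg_le Φ _ hT⟩ : totalLieAlgebraRat Φ) ∈
      adDegree ℚ (⟨countingG E, countingG_mem_totalLieAlgebraRat Φ⟩ : totalLieAlgebraRat Φ) q :=
    (mem_adDegree_totalLieAlgebraRat_iff Φ).2 hT
  rw [h, Submodule.mem_bot] at hT'
  rw [Submodule.mem_bot]
  exact congrArg Subtype.val hT'

/-- **`g = 1`: `𝔤_tot(X; ℚ)₂ = ℚ · e_η`** for every rational non-degenerate `η` (row A1-84's `𝔤₂ = K e` for `𝔰𝔩₂`).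
[cite: LooijengaLunts1997, §2 (2.6) (case (A₁, ∅)), (2.9) ("for m = 1"), §3 (3.3)] -/
theorem totalLieAlgebraRatDeg_two_eq_span_of_finrank_eq_one (h1 : finrank ℂ E = 1) {η : E [⋀^Fin 2]→L[ℝ] ℝ}
    (hη : ofRealForm η ∈ rationalForms Φ 2) (hnd : ∀ v : E, v ≠ 0 → ∃ w : E, η ![v, w] ≠ 0) :
    totalLieAlgebraRatDeg Φ 2 = ℚ ∙ lefschetzG η := by
  have t := isSl2Triple_totalLieAlgebraRat Φ hη hnd
  refine le_antisymm (fun T hT ↦ ?_) ?_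
  · have hT' := (mem_adDegree_two_totalLieAlgebraRat_iff Φ (x := ⟨T, totalLieAlgebraRatDeg_le Φ _ hT⟩)).2 hT
    obtain ⟨b, hb⟩ := (mem_adDegree_two_iff_of_isSl2Triple t (fun x ↦ by
      obtain ⟨a, b, c, hx⟩ := exists_eq_smul_add_of_finrank_eq_one Φ h1 hη hnd x.2
      exact ⟨a, b, c, Subtype.ext hx⟩)).1 hT'
    exact Submodule.mem_span_singleton.2 ⟨b, (congrArg Subtype.val hb).symm⟩
  · exact (Submodule.span_singleton_le_iff_mem _ _).2 (lefschetzTriple_mem_totalLieAlgebraRatDeg Φ hη hnd).1.1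

/-- **`g = 1`: `𝔤_tot(X; ℚ)₀ = ℚ · h`** (row A1-84 §6 `mem_adDegree_zero_iff_of_isSl2Triple`: `𝔤₀ = K h` for `𝔰𝔩₂`; for
`g ≥ 2` instead `𝔤₀ ≅ 𝔤𝔩_{2g}(ℚ)`, row A1-75). [cite: LooijengaLunts1997, Introduction p. 2, §2 (2.2), (2.6) (m = 1)] -/
theorem totalLieAlgebraRatDeg_zero_eq_span_of_finrank_eq_one (h1 : finrank ℂ E = 1) :
    totalLieAlgebraRatDeg Φ 0 = ℚ ∙ countingG E := by
  obtain ⟨η, hη, hnd⟩ := exists_rational_nondegenerate_twoForm Φ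
  have t := isSl2Triple_totalLieAlgebraRat Φ hη hnd
  refine le_antisymm (fun T hT ↦ ?_) ?_
  · have hT' : (⟨T, totalLieAlgebraRatDeg_le Φ _ hT⟩ : totalLieAlgebraRat Φ) ∈
        adDegree ℚ (⟨countingG E, countingG_mem_totalLieAlgebraRat Φ⟩ : totalLieAlgebraRat Φ) 0 :=
      (mem_adDegree_totalLieAlgebraRat_iff Φ).2 (by rwa [Rat.cast_zero])
    obtain ⟨a, ha⟩ := (mem_adDegree_zero_iff_of_isSl2Triple t (fun x ↦ by
      obtain ⟨a, b, c, hx⟩ := exists_eq_smul_add_of_finrank_eq_one Φ h1 hη hnd x.2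
      exact ⟨a, b, c, Subtype.ext hx⟩)).1 hT'
    exact Submodule.mem_span_singleton.2 ⟨a, (congrArg Subtype.val ha).symm⟩
  · exact (Submodule.span_singleton_le_iff_mem _ _).2 (lefschetzTriple_mem_totalLieAlgebraRatDeg Φ hη hnd).1.2.1

/-- **`g = 1`: `𝔤_tot(X; ℚ)₋₂ = ℚ · f_η`** for every rational non-degenerate `η` (row A1-84 §6
`mem_adDegree_neg_two_iff_of_isSl2Triple`). [cite: LooijengaLunts1997, Introduction p. 2, §2 (2.2), (2.6) (m = 1)] -/
theorem totalLieAlgebraRatDeg_negTwo_eq_span_of_finrank_eq_one (h1 : finrank ℂ E = 1) {η : E [⋀^Fin 2]→L[ℝ] ℝ}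
    (hη : ofRealForm η ∈ rationalForms Φ 2) (hnd : ∀ v : E, v ≠ 0 → ∃ w : E, η ![v, w] ≠ 0) :
    totalLieAlgebraRatDeg Φ (-2) = ℚ ∙ lefschetzDualG η := by
  have t := isSl2Triple_totalLieAlgebraRat Φ hη hnd
  refine le_antisymm (fun T hT ↦ ?_) ?_
  · have hT' : (⟨T, totalLieAlgebraRatDeg_le Φ _ hT⟩ : totalLieAlgebraRat Φ) ∈
        adDegree ℚ (⟨countingG E, countingG_mem_totalLieAlgebraRat Φ⟩ : totalLieAlgebraRat Φ) (-2) :=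
      (mem_adDegree_totalLieAlgebraRat_iff Φ).2 (by rwa [Rat.cast_neg, Rat.cast_ofNat])
    obtain ⟨c, hc⟩ := (mem_adDegree_neg_two_iff_of_isSl2Triple t (fun x ↦ by
      obtain ⟨a, b, c, hx⟩ := exists_eq_smul_add_of_finrank_eq_one Φ h1 hη hnd x.2
      exact ⟨a, b, c, Subtype.ext hx⟩)).1 hT'
    exact Submodule.mem_span_singleton.2 ⟨c, (congrArg Subtype.val hc).symm⟩
  · exact (Submodule.span_singleton_le_iff_mem _ _).2 (lefschetzTriple_mem_totalLieAlgebraRatDeg Φ hη hnd).1.2.2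

/-- **`g = 1`: the three pieces are LINES — `dim_ℚ 𝔤_tot(X; ℚ)₂ = dim_ℚ 𝔤₀ = dim_ℚ 𝔤₋₂ = 1`** (`1 + 1 + 1 = 3`; compare
row A1-75's `g ≥ 2` table `C(2g, 2) + (2g)² + C(2g, 2)`, whose `𝔤₀`-entry `(2g)² = 4 ≠ 1` at `g = 1`: the hypothesis
`g ≥ 2` of the `𝔰𝔬(V_ℚ ⊕ V_ℚ^*)`-description is sharp). [cite: LooijengaLunts1997, Introduction p. 2, §2 (2.6) (m = 1), §3 (3.3)] -/
theorem finrank_totalLieAlgebraRatDeg_of_finrank_eq_one (h1 : finrank ℂ E = 1) :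
    finrank ℚ (totalLieAlgebraRatDeg Φ 2) = 1 ∧ finrank ℚ (totalLieAlgebraRatDeg Φ 0) = 1 ∧
      finrank ℚ (totalLieAlgebraRatDeg Φ (-2)) = 1 := by
  obtain ⟨η, hη, hnd⟩ := exists_rational_nondegenerate_twoForm Φ
  have t := isSl2Triple_totalLieAlgebraRat Φ hη hnd
  refine ⟨?_, ?_, ?_⟩
  · rw [totalLieAlgebraRatDeg_two_eq_span_of_finrank_eq_one Φ h1 hη hnd]
    exact finrank_span_singleton fun h0 ↦ t.e_ne_zero (Subtype.ext h0)
  · rw [totalLieAlgebraRatDeg_zero_eq_span_of_finrank_eq_one Φ h1]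
    exact finrank_span_singleton (countingG_ne_zero (E := E))
  · rw [totalLieAlgebraRatDeg_negTwo_eq_span_of_finrank_eq_one Φ h1 hη hnd]
    exact finrank_span_singleton fun h0 ↦ t.f_ne_zero (Subtype.ext h0)

/-- **`g = 1`: the `𝔰𝔩₂`-triple `(e_η, h, f_η)` generates ALL of `𝔤_tot(X; ℚ)`** — Mathlib's `IsSl2Triple.toLieSubalgebra`
of the triple inside `𝔤_tot(X; ℚ)` is `⊤`. [cite: LooijengaLunts1997, Introduction p. 2 ("e_κ, h, f_κ make up a Lie subalgebra 𝔤_κ … isomorphic to 𝔰𝔩(2)"), §2 (2.6) (m = 1)] -/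
theorem toLieSubalgebra_eq_top_of_finrank_eq_one (h1 : finrank ℂ E = 1) {η : E [⋀^Fin 2]→L[ℝ] ℝ}
    (hη : ofRealForm η ∈ rationalForms Φ 2) (hnd : ∀ v : E, v ≠ 0 → ∃ w : E, η ![v, w] ≠ 0) :
    (isSl2Triple_totalLieAlgebraRat Φ hη hnd).toLieSubalgebra ℚ = ⊤ := by
  refine eq_top_iff.2 fun x _ ↦ ?_
  obtain ⟨a, b, c, hx⟩ := exists_eq_smul_add_of_finrank_eq_one Φ h1 hη hnd x.2
  refine IsSl2Triple.mem_toLieSubalgebra_iff.2 ⟨b, c, a, ?_⟩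
  rw [(isSl2Triple_totalLieAlgebraRat Φ hη hnd).lie_e_f]
  apply Subtype.ext
  rw [hx]
  show a • countingG E + b • lefschetzG η + c • lefschetzDualG η =
    b • lefschetzG η + c • lefschetzDualG η + a • countingG E
  abel

/-- **THE ELLIPTIC CURVE, AS PRINTED: `𝔤_tot(X; ℚ) ≅ 𝔰𝔩₂(ℚ)` as Lie algebras over `ℚ`** (`g = 1`; through row A1-78's
`Sl2Triple.equivSl`: `e_η ↦ (0 1; 0 0)`, `f_η ↦ (0 0; 1 0)`, `h ↦ (1 0; 0 -1)`; existence form, the rational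
non-degenerate `η` produced inside). [cite: LooijengaLunts1997, Introduction p. 2 ("The elements e_κ, h, f_κ make up a Lie subalgebra 𝔤_κ of 𝔤𝔩(H(X)) isomorphic to 𝔰𝔩(2)"), §1 (1.9) (K-points), §2 (2.6) (m = 1)] -/
theorem nonempty_lieEquiv_totalLieAlgebraRat_sl_two_of_finrank_eq_one (h1 : finrank ℂ E = 1) :
    Nonempty (totalLieAlgebraRat Φ ≃ₗ⁅ℚ⁆ LieAlgebra.SpecialLinear.sl (Fin 2) ℚ) := by
  obtain ⟨η, hη, hnd⟩ := exists_rational_nondegenerate_twoForm Φ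
  have htop := toLieSubalgebra_eq_top_of_finrank_eq_one Φ h1 hη hnd
  exact ⟨LieSubalgebra.topEquiv.symm.trans ((LieEquiv.ofEq _ _ (congrArg SetLike.coe htop.symm)).trans
    (Sl2Triple.equivSl ℚ (isSl2Triple_totalLieAlgebraRat Φ hη hnd)))⟩

omit [Fintype ι] [DecidableEq ι] [Nontrivial E] Φ in
/-- … and over `ℝ`: **`𝔤_tot(X; ℝ) ≅ 𝔰𝔩₂(ℝ)` for `g = 1`** (row A1-51's `totalLieAlgebra_eq_toLieSubalgebra` — `𝔤_tot(X; ℝ)`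
is the Lie algebra of the triple of a frame form — composed with row A1-78's `Sl2Triple.equivSl`).
[cite: LooijengaLunts1997, Introduction p. 2, §1 (1.9), §3 (3.2)–(3.3)] -/
theorem nonempty_lieEquiv_totalLieAlgebra_sl_two_of_finrank_eq_one (h1 : finrank ℂ E = 1) :
    Nonempty (totalLieAlgebra E ≃ₗ⁅ℝ⁆ LieAlgebra.SpecialLinear.sl (Fin 2) ℝ) := by
  haveI : Nontrivial E := Module.nontrivial_of_finrank_pos (R := ℂ) (by omega)
  have h2 : finrank ℝ E = 1 + 1 := by rw [finrank_real_of_complex, h1]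
  let b : Module.Basis (Fin 1 ⊕ Fin 1) ℝ E := (Module.finBasis ℝ E).reindex ((finCongr h2).trans finSumFinEquiv.symm)
  -- (the Lie instances of the ambient `𝔤𝔩` are filled by unification, `(_)`, not by synthesis — no local instance)
  exact ⟨(@LieEquiv.ofEq ℝ _ _ (_) (_) _ _ (congrArg SetLike.coe (totalLieAlgebra_eq_toLieSubalgebra b))).trans
    (@Sl2Triple.equivSl ℝ _ _ (_) (_) _ _ _ _ (isSl2Triple (frameForm_nondegenerate b)))⟩

end EveryDimension

/-! ### §4 The polarised elliptic curve: `𝔤_NS(X; ℚ) = 𝔤_tot(X; ℚ)` and `𝔤_NS(X; ℝ) = 𝔤_tot(X; ℝ)` -/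

section EllipticCurveNeronSeveri

variable {ι : Type*} [Fintype ι] [DecidableEq ι] {E : Type*} [NormedAddCommGroup E] [NormedSpace ℂ E]
  [FiniteDimensional ℂ E] [Nontrivial E] (Φ : (ι → ℝ) ≃L[ℝ] E) {η₀ : E [⋀^Fin 2]→L[ℝ] ℝ} (hη₀ : IsRiemannForm Φ η₀)
include hη₀

/-- **For a polarised elliptic curve the Néron–Severi and the total Lie algebras over `ℚ` COINCIDE:
`𝔤_NS(X; ℚ) = 𝔤_tot(X; ℚ)`** (`g = 1`: `NS_ℚ(X) ∋ η₀` and `𝔤_tot(X; ℚ) = ℚ h ⊕ ℚ e_{η₀} ⊕ ℚ f_{η₀}` by §3, all three in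
`𝔤_NS(X; ℚ)` — rows A1-78; in general only `𝔤_NS ⊆ 𝔤_tot`, row A1-71 `neronSeveriLieAlgebraRat_le_totalLieAlgebraRat`).
[cite: LooijengaLunts1997, §1 (1.9) p. 6 ("take for 𝔞 the Néron–Severi group NS(X) … the Néron–Severi Lie algebra of X (denoted 𝔤_NS(X)). It is defined over ℚ"), Introduction p. 2, §3 (3.8) (m = 1)] -/
theorem IsRiemannForm.neronSeveriLieAlgebraRat_eq_totalLieAlgebraRat_of_finrank_eq_one (h1 : finrank ℂ E = 1) :
    neronSeveriLieAlgebraRat Φ = totalLieAlgebraRat Φ := by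
  refine le_antisymm (neronSeveriLieAlgebraRat_le_totalLieAlgebraRat Φ) fun T hT ↦ ?_
  have hη : η₀ ∈ neronSeveriQ Φ := mem_neronSeveriQ_of_isRiemannForm Φ hη₀
  have hnd := nondegenerate_of_pos hη₀.2.2
  obtain ⟨a, b, c, rfl⟩ :=
    exists_eq_smul_add_of_finrank_eq_one Φ h1 (ofRealForm_mem_rationalForms_of_mem_neronSeveriQ Φ hη) hnd hT
  exact Submodule.add_mem _ (Submodule.add_mem _
    (Submodule.smul_mem _ a (neronSeveriLieAlgebraRatDeg_le Φ 0
      ⟨hη₀.countingG_mem_neronSeveriLieAlgebraRat Φ, by rw [Ring.lie_def, sub_self, zero_smul]⟩))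
    (Submodule.smul_mem _ b (neronSeveriLieAlgebraRatDeg_le Φ 2 (lefschetzG_mem_neronSeveriLieAlgebraRatDeg_two Φ hη))))
    (Submodule.smul_mem _ c (neronSeveriLieAlgebraRatDeg_le Φ (-2)
      (lefschetzDualG_mem_neronSeveriLieAlgebraRatDeg_negTwo Φ hη hnd)))

/-- … hence the two Jordan–Lefschetz pairs `(𝔤_NS(X; ℚ), h)` (§2) and `(𝔤_tot(X; ℚ), h)` (§3) of a polarised elliptic
curve are built on the SAME `ℚ`-Lie algebra `≅ 𝔰𝔩₂(ℚ)`: `𝔤_NS(X; ℚ) ≅ 𝔰𝔩₂(ℚ)` as well (row A1-78's Picard-number-one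
statement, recovered). [cite: LooijengaLunts1997, Introduction p. 2, §3 (3.8) (m = 1)] -/
theorem IsRiemannForm.nonempty_lieEquiv_neronSeveriLieAlgebraRat_sl_two_of_finrank_eq_one (h1 : finrank ℂ E = 1) :
    Nonempty (neronSeveriLieAlgebraRat Φ ≃ₗ⁅ℚ⁆ LieAlgebra.SpecialLinear.sl (Fin 2) ℚ) := by
  rw [hη₀.neronSeveriLieAlgebraRat_eq_totalLieAlgebraRat_of_finrank_eq_one Φ h1]
  exact nonempty_lieEquiv_totalLieAlgebraRat_sl_two_of_finrank_eq_one Φ h1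

/-- **… and over `ℝ`: `𝔤_NS(X; ℝ) = 𝔤_tot(X; ℝ)` for a polarised elliptic curve** (`𝔤_NS ⊆ 𝔤_tot`, row A1-54
`neronSeveriLieAlgebra_le_totalLieAlgebra`, and both have dimension `3`: row A1-78
`IsRiemannForm.finrank_neronSeveriLieAlgebra_of_finrank_eq_one` with `ρ = 1` (row A1-66
`finrank_neronSeveriGroup_eq_one_of_finrank_eq_one`), row A1-71 `finrank_totalLieAlgebra_of_finrank_eq_one`).
[cite: LooijengaLunts1997, §1 (1.9) p. 6, §3 (3.2)–(3.3)] -/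
theorem IsRiemannForm.neronSeveriLieAlgebra_eq_totalLieAlgebra_of_finrank_eq_one (h1 : finrank ℂ E = 1) :
    neronSeveriLieAlgebra Φ = totalLieAlgebra E := by
  have hle := neronSeveriLieAlgebra_le_totalLieAlgebra Φ
  -- equality of the underlying `ℝ`-subspaces by `dim = 3 = dim` (instances of the ambient `𝔤𝔩` by unification, `(_)`)
  have key : @LieSubalgebra.toSubmodule ℝ _ _ (_) (_) (neronSeveriLieAlgebra Φ) =
      @LieSubalgebra.toSubmodule ℝ _ _ (_) (_) (totalLieAlgebra E) :=
    Submodule.eq_of_le_of_finrank_eq (fun _ h ↦ hle h)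
      ((hη₀.finrank_neronSeveriLieAlgebra_of_finrank_eq_one Φ
        (finrank_neronSeveriGroup_eq_one_of_finrank_eq_one Φ h1)).trans (finrank_totalLieAlgebra_of_finrank_eq_one h1).symm)
  refine le_antisymm hle fun T hT ↦ ?_
  have hT' : T ∈ @LieSubalgebra.toSubmodule ℝ _ _ (_) (_) (totalLieAlgebra E) := hT
  rw [← key] at hT'
  exact hT'

omit hη₀ in
/-- The same for an abelian variety of dimension `1` (`IsAbelianVariety Φ`: some polarisation exists).
[cite: LooijengaLunts1997, §1 (1.9) p. 6, §3 (3.8) (m = 1)] -/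
theorem IsAbelianVariety.neronSeveriLieAlgebraRat_eq_totalLieAlgebraRat_of_finrank_eq_one (hX : IsAbelianVariety Φ)
    (h1 : finrank ℂ E = 1) :
    neronSeveriLieAlgebraRat Φ = totalLieAlgebraRat Φ ∧ neronSeveriLieAlgebra Φ = totalLieAlgebra E := by
  obtain ⟨η₀, hη₀⟩ := hX
  exact ⟨hη₀.neronSeveriLieAlgebraRat_eq_totalLieAlgebraRat_of_finrank_eq_one Φ h1,
    hη₀.neronSeveriLieAlgebra_eq_totalLieAlgebra_of_finrank_eq_one Φ h1⟩

end EllipticCurveNeronSeveri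

/-! ### §5 The model of the class `(A₁, ∅)`: `(𝔰𝔩₂(K), H)` is a Jordan–Lefschetz pair, and the elliptic curve's pair is isomorphic to it -/

section ModelPair

variable (K : Type*) [Field K] [CharZero K]

-- (On this Mathlib pin the commutator Lie structure of `M₂(K)` is not a global instance; rows A1-41…A1-78 enable it
-- locally.  Here, as in §3–§4, no local instance is used: the few lemmas about the ambient `M₂(K)` receive their Lie
-- instances by unification, `@… (_) (_)`, from the type of row A1-78's `Sl2Triple.isSl2Triple_std K`.)

omit [CharZero K] in
/-- `H = (1 0; 0 -1) ∈ 𝔰𝔩₂(K)`. [cite: Humphreys1972, §2.1 Example (standard basis x, y, h of 𝔰𝔩(2, F))] [cite: LooijengaLunts1997, §2 (2.6) (m = 1)] -/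
theorem stdH_mem_sl : Sl2Triple.stdH K ∈ LieAlgebra.SpecialLinear.sl (Fin 2) K :=
  Sl2Triple.toLieSubalgebra_std_eq_sl K ▸
    @Sl2Triple.h_mem_toLieSubalgebra K _ _ (_) (_) _ _ _ (Sl2Triple.isSl2Triple_std K)

omit [CharZero K] in
/-- `X = (0 1; 0 0) ∈ 𝔰𝔩₂(K)`. [cite: Humphreys1972, §2.1 Example] [cite: LooijengaLunts1997, §2 (2.6) (m = 1)] -/
theorem stdE_mem_sl : Sl2Triple.stdE K ∈ LieAlgebra.SpecialLinear.sl (Fin 2) K :=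
  Sl2Triple.toLieSubalgebra_std_eq_sl K ▸
    @Sl2Triple.e_mem_toLieSubalgebra K _ _ (_) (_) _ _ _ (Sl2Triple.isSl2Triple_std K)

omit [CharZero K] in
/-- `Y = (0 0; 1 0) ∈ 𝔰𝔩₂(K)`. [cite: Humphreys1972, §2.1 Example] [cite: LooijengaLunts1997, §2 (2.6) (m = 1)] -/
theorem stdF_mem_sl : Sl2Triple.stdF K ∈ LieAlgebra.SpecialLinear.sl (Fin 2) K :=
  Sl2Triple.toLieSubalgebra_std_eq_sl K ▸
    @Sl2Triple.f_mem_toLieSubalgebra K _ _ (_) (_) _ _ _ (Sl2Triple.isSl2Triple_std K)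

omit [CharZero K] in
/-- The standard triple `(X, H, Y)` as an `𝔰𝔩₂`-triple INSIDE the Lie algebra `𝔰𝔩₂(K)` (row A1-78's `isSl2Triple_std` is
stated in `M₂(K)`). [cite: Humphreys1972, §2.1 Example ([xy] = h, [hx] = 2x, [hy] = −2y)] [cite: LooijengaLunts1997, §1 (1.1) p. 4] -/
theorem isSl2Triple_sl_two_std :
    IsSl2Triple (⟨Sl2Triple.stdH K, stdH_mem_sl K⟩ : LieAlgebra.SpecialLinear.sl (Fin 2) K)
      ⟨Sl2Triple.stdE K, stdE_mem_sl K⟩ ⟨Sl2Triple.stdF K, stdF_mem_sl K⟩ where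
  h_ne_zero h0 := @IsSl2Triple.h_ne_zero _ (_) _ _ _ (Sl2Triple.isSl2Triple_std K) (congrArg Subtype.val h0)
  lie_e_f := Subtype.ext (@IsSl2Triple.lie_e_f _ (_) _ _ _ (Sl2Triple.isSl2Triple_std K))
  lie_h_e_nsmul := Subtype.ext (@IsSl2Triple.lie_h_e_nsmul _ (_) _ _ _ (Sl2Triple.isSl2Triple_std K))
  lie_h_f_nsmul := Subtype.ext (@IsSl2Triple.lie_h_f_nsmul _ (_) _ _ _ (Sl2Triple.isSl2Triple_std K))

omit [CharZero K] in
/-- Every element of `𝔰𝔩₂(K)` is `a H + b X + c Y` (row A1-78 `Sl2Triple.eq_combination_of_trace_eq_zero`, inside the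
subtype). [cite: Humphreys1972, §2.1 Example ("Take as standard basis for L the three matrices")] [cite: LooijengaLunts1997, §2 (2.6) (m = 1)] -/
theorem exists_eq_smul_add_sl_two (x : LieAlgebra.SpecialLinear.sl (Fin 2) K) :
    ∃ a b c : K, x = a • (⟨Sl2Triple.stdH K, stdH_mem_sl K⟩ : LieAlgebra.SpecialLinear.sl (Fin 2) K) +
      b • ⟨Sl2Triple.stdE K, stdE_mem_sl K⟩ + c • ⟨Sl2Triple.stdF K, stdF_mem_sl K⟩ := by
  have hx := Sl2Triple.eq_combination_of_trace_eq_zero K (A := (x : Matrix (Fin 2) (Fin 2) K)) x.2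
  refine ⟨(x : Matrix (Fin 2) (Fin 2) K) 0 0, (x : Matrix (Fin 2) (Fin 2) K) 0 1, (x : Matrix (Fin 2) (Fin 2) K) 1 0,
    Subtype.ext (hx.trans ?_)⟩
  show (x : Matrix (Fin 2) (Fin 2) K) 0 1 • Sl2Triple.stdE K + (x : Matrix (Fin 2) (Fin 2) K) 1 0 • Sl2Triple.stdF K +
      (x : Matrix (Fin 2) (Fin 2) K) 0 0 • Sl2Triple.stdH K =
    (x : Matrix (Fin 2) (Fin 2) K) 0 0 • Sl2Triple.stdH K + (x : Matrix (Fin 2) (Fin 2) K) 0 1 • Sl2Triple.stdE K +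
      (x : Matrix (Fin 2) (Fin 2) K) 1 0 • Sl2Triple.stdF K
  abel

/-- **THE MODEL OF THE CLASS `(A₁, ∅)`: `(𝔰𝔩₂(K), H)` IS A JORDAN–LEFSCHETZ PAIR** for every field `K` of characteristic
`0` (`𝔰𝔩₂(K)` is simple — the tree's `SpecialLinearSimple.isSimple_sl_of_charZero` — and spanned by the standard triple,
so row A1-84's `isJordanLefschetzPair_of_isSl2Triple` applies). [cite: LooijengaLunts1997, §2 (2.6) ("(A_{2m-1}, A_{m-1} + A_{m-1}) (m ≥ 1)": m = 1; "every item of this list determines an isomorphism class of Jordan–Lefschetz pairs")] [cite: Humphreys1972, §2.1 Example, §19.2] -/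
theorem isJordanLefschetzPair_sl_two :
    IsJordanLefschetzPair K (⟨Sl2Triple.stdH K, stdH_mem_sl K⟩ : LieAlgebra.SpecialLinear.sl (Fin 2) K) := by
  haveI : LieAlgebra.IsSimple K (LieAlgebra.SpecialLinear.sl (Fin 2) K) :=
    Literature.Algebra.Lie.SpecialLinearSimple.isSimple_sl_of_charZero (Fin 2) K (by simp)
  exact isJordanLefschetzPair_of_isSl2Triple (isSl2Triple_sl_two_std K) (exists_eq_smul_add_sl_two K)

/-- `dim 𝔰𝔩₂(K) = 3` (row A1-84 §6 `finrank_eq_three_of_isSl2Triple` on the model; row A1-78 has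
`Sl2Triple.finrank_toLieSubalgebra` for the subalgebra of a triple). [cite: LooijengaLunts1997, §2 (2.6) (m = 1)] [cite: Humphreys1972, §2.1 Example] -/
theorem finrank_sl_two_eq_three : finrank K (LieAlgebra.SpecialLinear.sl (Fin 2) K) = 3 :=
  finrank_eq_three_of_isSl2Triple (isSl2Triple_sl_two_std K) (exists_eq_smul_add_sl_two K)

end ModelPair

section ModelPairTorus

variable {ι : Type*} [Fintype ι] [DecidableEq ι] {E : Type*} [NormedAddCommGroup E] [NormedSpace ℂ E]
  [FiniteDimensional ℂ E] [Nontrivial E] (Φ : (ι → ℝ) ≃L[ℝ] E)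

/-- **The elliptic curve's pair IS the model up to isomorphism**: for `g = 1` there is a Lie algebra isomorphism
`e : 𝔤_tot(X; ℚ) ≃ 𝔰𝔩₂(ℚ)` with `e h = H` (row A1-78's `Sl2Triple.equivSl`: `h ↦ (1 0; 0 -1)`), along which the
Jordan–Lefschetz pair `(𝔤_tot(X; ℚ), h)` of §3 is carried to `(𝔰𝔩₂(ℚ), H)` (row A1-87 `IsJordanLefschetzPair.map`).
[cite: LooijengaLunts1997, Introduction p. 2 ("isomorphic to 𝔰𝔩(2)"), §2 (2.6) ("isomorphism class of Jordan–Lefschetz pairs", m = 1)] -/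
theorem exists_lieEquiv_sl_two_map_countingG_of_finrank_eq_one (h1 : finrank ℂ E = 1) :
    ∃ e : totalLieAlgebraRat Φ ≃ₗ⁅ℚ⁆ LieAlgebra.SpecialLinear.sl (Fin 2) ℚ,
      e ⟨countingG E, countingG_mem_totalLieAlgebraRat Φ⟩ = ⟨Sl2Triple.stdH ℚ, stdH_mem_sl ℚ⟩ ∧
        IsJordanLefschetzPair ℚ (e ⟨countingG E, countingG_mem_totalLieAlgebraRat Φ⟩) := by
  obtain ⟨η, hη, hnd⟩ := exists_rational_nondegenerate_twoForm Φ
  have htop := toLieSubalgebra_eq_top_of_finrank_eq_one Φ h1 hη hnd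
  let t := isSl2Triple_totalLieAlgebraRat Φ hη hnd
  let e : totalLieAlgebraRat Φ ≃ₗ⁅ℚ⁆ LieAlgebra.SpecialLinear.sl (Fin 2) ℚ :=
    LieSubalgebra.topEquiv.symm.trans ((LieEquiv.ofEq _ _ (congrArg SetLike.coe htop.symm)).trans
      (Sl2Triple.equivSl ℚ t))
  refine ⟨e, ?_, (isJordanLefschetzPair_totalLieAlgebraRat_of_finrank_eq_one Φ h1).map e⟩
  apply Subtype.ext
  change ((Sl2Triple.equivSl ℚ t (LieEquiv.ofEq _ _ (congrArg SetLike.coe htop.symm)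
    (LieSubalgebra.topEquiv.symm ⟨countingG E, countingG_mem_totalLieAlgebraRat Φ⟩)) :
      LieAlgebra.SpecialLinear.sl (Fin 2) ℚ) : Matrix (Fin 2) (Fin 2) ℚ) = Sl2Triple.stdH ℚ
  have hmem : (⟨countingG E, countingG_mem_totalLieAlgebraRat Φ⟩ : totalLieAlgebraRat Φ) ∈ t.toLieSubalgebra ℚ :=
    Sl2Triple.h_mem_toLieSubalgebra ℚ t
  have h2 : LieEquiv.ofEq _ _ (congrArg SetLike.coe htop.symm)
      (LieSubalgebra.topEquiv.symm ⟨countingG E, countingG_mem_totalLieAlgebraRat Φ⟩) = ⟨_, hmem⟩ :=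
    Subtype.ext rfl
  rw [h2, Sl2Triple.coe_equivSl_h]
  rfl

end ModelPairTorus

end ComplexTorus

end Literature.Geometry.Kaehler
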